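import Summits.BirchSwinnertonDyer.BirchSwinnertonDyer.Theorems.Rank1ResidualX11RankOneMinimality
import Summits.BirchSwinnertonDyer.BirchSwinnertonDyer.Theorems.Rank1ResidualIntModelReduction
import Summits.BirchSwinnertonDyer.BirchSwinnertonDyer.Theorems.Rank1ResidualX11RankOneFrobeniusCards1
import Summits.BirchSwinnertonDyer.BirchSwinnertonDyer.Theorems.Rank1ResidualX11RankOneFrobeniusCards2
import HarnessLib

/-!
# BSD rank-≤1 residual cell, class X11 ∧ r = 1 ∧ ¬sst ∧ p ≥ 5: the FINITE conjuncts of the 85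
# records' `Claim` — `Mult`, split type, `¬ Semistable`, (ram), `Irr` — are KERNEL THEOREMS

HONEST FRAMING (cell `b2b-bsdres-*`, verbatim): prove what is provable now; shrink each hard class
to its core with data; no claim beyond stated classes; COMBINATION classes deleted from PUBLISHED
theorems only, CONSTRUCTION-shaped remainder typed; this is not "finishing BSD". Class X11b stays
CONSTRUCTION-SHAPED; everything here is PER PAIR; no lane verdict is changed; no named fact.

Theorems only. `X11RankOneCertificates/Claim.lean` (unit `b2b-bsdres-x11c`, gen 0) takes as ONE
hypothesis `r.Claim` the conjunction of engine outputs about the record's curve: analytic rank `1`,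
`Mult`, `Irr`, `¬ Semistable`, `Surj` (if Serre witnesses), `Ram` (if (ram) witnesses), split /
non-split, `#Ш_an`, and the `p`-adic certificate. Five of these are statements about the explicit
integer model that the tree can now VERIFY: this file proves, for every one of the 85 records
(`records1 ++ records2`, window `N < 2·10⁴`), from kernel-decided integer certificates and the
generic integer-model lemmas of `Rank1ResidualIntModelReduction.lean`:

* `reductionCert_all` (`decide`): `p ∣ Δ`, `p ∤ c₄`; a root / no root `t < p` of the node-tangent
  quadratic `c₄t² + a₁c₄t − (54b₆ − 3b₂b₄ + a₂c₄)` mod `p` according to `split`; an additive prime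
  (`q ∣ Δ`, `q ∣ c₄`, `q` prime by trial division) — every record is non-semistable; and, when the
  record lists (ram) witnesses, a prime `ℓ ≠ p` of `bad` with `ℓ ∣ Δ`, `ℓ ∤ c₄`, `ℓᵉ ‖ Δ`, `p ∤ e`;
* `irrCert_all`: for each record a good odd prime `ℓ ≠ p` (`ℓ ∤ Δ`) with the KERNEL-DECIDED point
  count `#Ẽ(𝔽_ℓ) = n` (`Rank1ResidualX11RankOneFrobeniusCards{1,2}.lean`) such that
  `X² − (ℓ + 1 − n)X + ℓ` has no root mod `p` (decided here);
* `reduction_of_mem`: hence, for every record `r`, IN THE KERNEL: `Mult r.curve r.p`,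
  `r.split = true → split multiplicative`, `r.split = false → non-split`, `¬ Semistable r.curve`,
  `r.ram ≠ [] → Ram r.curve r.p`, and `Irr r.curve r.p` (Mazur 1978 Prop. 6.3 (1)) — for ANY
  instances `[Fact r.p.Prime] [IsElliptic] [IsGloballyMinimal]` (all three are themselves kernel
  theorems: `Instances.lean`, `Rank1ResidualX11RankOneMinimality.lean`).

What is left of `Claim` as a genuine hypothesis: analytic rank `= 1`, `#Ш_an = 1`, the `p`-adic
valuation identity, and — only where the (ram) route is unavailable (11 records) — surjectivity of
`ρ̄_{E,p}` (consumer file `Rank1ResidualX11RankOneCore.lean`).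

References: J. H. Silverman, *AEC* (2009) VII.5 Prop. 5.1 [SilvermanAEC2009]; B. Mazur, Invent. Math.
44 (1978) Prop. 6.3 (1) [Mazur1978]; Skinner–Urban 2014 Thm. 2 ((ram)) [SkinnerUrban2014]; Cremona's
tables [Cremona2006].
-/

set_option linter.dupNamespace false
set_option autoImplicit false

open scoped Classical

open WeierstrassCurve Literature.NumberTheory.EllipticCurves
  Literature.NumberTheory.EllipticCurves.Rank1Residual
  Literature.NumberTheory.EllipticCurves.Rank1Residual.X11RankOneCertificates
  Summit.BirchSwinnertonDyer.BirchSwinnertonDyer.Rank1Residual.IntModel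

namespace Summit.BirchSwinnertonDyer.BirchSwinnertonDyer.Rank1Residual.X11RankOne

/-! ### §1. From the a-invariant list to the integer curve -/

/-- `Δ` of the integer curve is the recheck's `discOf`. [cite: SilvermanAEC2009, III.1] -/
theorem intCurve_Δ (a1 a2 a3 a4 a6 : ℤ) :
    (⟨a1, a2, a3, a4, a6⟩ : WeierstrassCurve ℤ).Δ = discOf [a1, a2, a3, a4, a6] := by
  simp only [WeierstrassCurve.Δ, WeierstrassCurve.b₂, WeierstrassCurve.b₄, WeierstrassCurve.b₆,
    WeierstrassCurve.b₈, discOf, invariants]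
  ring

/-- `c₄` of the integer curve is the recheck's `c4Of`. [cite: SilvermanAEC2009, III.1] -/
theorem intCurve_c₄ (a1 a2 a3 a4 a6 : ℤ) :
    (⟨a1, a2, a3, a4, a6⟩ : WeierstrassCurve ℤ).c₄ = c4Of [a1, a2, a3, a4, a6] := by
  simp only [WeierstrassCurve.c₄, WeierstrassCurve.b₂, WeierstrassCurve.b₄, c4Of, invariants]
  ring

/-- `b₂` of the integer curve from `invariants`. [cite: SilvermanAEC2009, III.1] -/
theorem intCurve_b₂ (a1 a2 a3 a4 a6 : ℤ) :
    (⟨a1, a2, a3, a4, a6⟩ : WeierstrassCurve ℤ).b₂ = (invariants [a1, a2, a3, a4, a6]).1 := by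
  simp only [WeierstrassCurve.b₂, invariants]; ring

/-- `b₄` of the integer curve from `invariants`. [cite: SilvermanAEC2009, III.1] -/
theorem intCurve_b₄ (a1 a2 a3 a4 a6 : ℤ) :
    (⟨a1, a2, a3, a4, a6⟩ : WeierstrassCurve ℤ).b₄ = (invariants [a1, a2, a3, a4, a6]).2.1 := by
  simp only [WeierstrassCurve.b₄, invariants]

/-- `b₆` of the integer curve from `invariants`. [cite: SilvermanAEC2009, III.1] -/
theorem intCurve_b₆ (a1 a2 a3 a4 a6 : ℤ) :
    (⟨a1, a2, a3, a4, a6⟩ : WeierstrassCurve ℤ).b₆ = (invariants [a1, a2, a3, a4, a6]).2.2.1 := by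
  simp only [WeierstrassCurve.b₆, invariants]; ring

/-- The tree's integral model of a record's (globally minimal) curve IS the record's integer
equation. [folklore] -/
theorem integralModelInt_curve (r : Record) {a1 a2 a3 a4 a6 : ℤ} (hA : r.ainvs = [a1, a2, a3, a4, a6])
    [r.curve.IsGloballyMinimal] : integralModelInt r.curve = ⟨a1, a2, a3, a4, a6⟩ :=
  integralModelInt_eq_of_map_eq _ (by rw [Record.curve_of_eq hA, map_mk_int])

/-- From `∀ t < p` over `ℕ` to `∀ t : ZMod p`. [folklore] -/
theorem forall_zmod_of_forall_lt {p : ℕ} [NeZero p] {P : ZMod p → Prop}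
    (h : ∀ t : ℕ, t < p → P (t : ZMod p)) : ∀ t : ZMod p, P t := fun t ↦ by
  simpa [ZMod.natCast_zmod_val] using h t.val (ZMod.val_lt t)

/-! ### §2. The decidable reduction certificates of all 85 records -/

-- `decide` recomputes `Δ`, `c₄`, `b₂`, `b₄`, `b₆` per record and searches `t < p ≤ 23`.
set_option maxRecDepth 100000 in
/-- **Reduction certificates, all 85 records** (kernel-evaluated): `p ∣ Δ ∧ p ∤ c₄`; a root (split) /
no root (non-split) `t < p` of the node-tangent quadratic mod `p`; an additive prime in `bad`; a (ram)
witness in `bad` whenever `ram ≠ []`. [folklore] -/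
theorem reductionCert_all : ∀ r ∈ records1 ++ records2,
    ((r.p : ℤ) ∣ discOf r.ainvs ∧ ¬ (r.p : ℤ) ∣ c4Of r.ainvs) ∧
    (r.split = true → ∃ t : ℕ, t < r.p ∧ (r.p : ℤ) ∣ c4Of r.ainvs * (t : ℤ) ^ 2 + r.ainvs.getD 0 0 * c4Of r.ainvs * t
        - (54 * (invariants r.ainvs).2.2.1 - 3 * (invariants r.ainvs).1 * (invariants r.ainvs).2.1
          + r.ainvs.getD 1 0 * c4Of r.ainvs)) ∧
    (r.split = false → ∀ t : ℕ, t < r.p → ¬ (r.p : ℤ) ∣ c4Of r.ainvs * (t : ℤ) ^ 2 + r.ainvs.getD 0 0 * c4Of r.ainvs * t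
        - (54 * (invariants r.ainvs).2.2.1 - 3 * (invariants r.ainvs).1 * (invariants r.ainvs).2.1
          + r.ainvs.getD 1 0 * c4Of r.ainvs)) ∧
    (∃ b ∈ r.bad, isPrimeBelow504100 b.1 = true ∧ (b.1 : ℤ) ∣ discOf r.ainvs ∧ (b.1 : ℤ) ∣ c4Of r.ainvs) ∧
    (r.ram ≠ [] → ∃ b ∈ r.bad, isPrimeBelow504100 b.1 = true ∧ b.1 ≠ r.p ∧ (b.1 : ℤ) ∣ discOf r.ainvs ∧
      ¬ (b.1 : ℤ) ∣ c4Of r.ainvs ∧ (b.1 : ℤ) ^ b.2.2 ∣ discOf r.ainvs ∧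
      ¬ (b.1 : ℤ) ^ (b.2.2 + 1) ∣ discOf r.ainvs ∧ ¬ r.p ∣ b.2.2) := by
  decide +kernel

/-! ### §3. The Frobenius witnesses for `Irr`, all 85 records -/

/-- **`Irr` certificates, all 85 records**: a witness prime `ℓ` (prime by trial division, `ℓ ≠ p`,
`ℓ ∤ Δ`), the kernel-decided point count `#Ẽ(𝔽_ℓ) = n` of `Rank1ResidualX11RankOneFrobeniusCards{1,2}`,
and root-freeness of `X² − (ℓ + 1 − n)X + ℓ` modulo `p` (decided). [cite: Mazur1978, §6 Prop. 6.3 (1) (p. 153)] -/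
theorem irrCert_all : ∀ r ∈ records1 ++ records2,
    ∃ ℓ n : ℕ, isPrimeBelow504100 ℓ = true ∧ ℓ ≠ r.p ∧ ¬ (ℓ : ℤ) ∣ discOf r.ainvs ∧
      (∀ t : ℕ, t < r.p → ¬ (r.p : ℤ) ∣ (t : ℤ) ^ 2 - ((ℓ : ℤ) + 1 - n) * t + ℓ) ∧
      (match r.ainvs with
        | [a1, a2, a3, a4, a6] =>
          Nat.card (((⟨a1, a2, a3, a4, a6⟩ : WeierstrassCurve ℤ).map
            (Int.castRingHom (ZMod ℓ))).toAffine.Point) = n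
        | _ => False) := by
  refine List.forall_mem_cons.mpr ⟨?_, ?_⟩
  · exact ⟨11, 16, by decide +kernel, by decide, by decide +kernel, by decide +kernel, card_c2760k1_11⟩
  refine List.forall_mem_cons.mpr ⟨?_, ?_⟩
  · exact ⟨13, 16, by decide +kernel, by decide, by decide +kernel, by decide +kernel, card_c3465d1_13⟩
  refine List.forall_mem_cons.mpr ⟨?_, ?_⟩
  · exact ⟨11, 18, by decide +kernel, by decide, by decide +kernel, by decide +kernel, card_c4230bg1_11⟩
  refine List.forall_mem_cons.mpr ⟨?_, ?_⟩
  · exact ⟨17, 24, by decide +kernel, by decide, by decide +kernel, by decide +kernel, card_c4230h1_17⟩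
  refine List.forall_mem_cons.mpr ⟨?_, ?_⟩
  · exact ⟨7, 12, by decide +kernel, by decide, by decide +kernel, by decide +kernel, card_c4590o1_7⟩
  refine List.forall_mem_cons.mpr ⟨?_, ?_⟩
  · exact ⟨19, 22, by decide +kernel, by decide, by decide +kernel, by decide +kernel, card_c6240be1_19⟩
  refine List.forall_mem_cons.mpr ⟨?_, ?_⟩
  · exact ⟨7, 9, by decide +kernel, by decide, by decide +kernel, by decide +kernel, card_c6390k1_7⟩
  refine List.forall_mem_cons.mpr ⟨?_, ?_⟩
  · exact ⟨7, 7, by decide +kernel, by decide, by decide +kernel, by decide +kernel, card_c6390p1_7⟩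
  refine List.forall_mem_cons.mpr ⟨?_, ?_⟩
  · exact ⟨17, 23, by decide +kernel, by decide, by decide +kernel, by decide +kernel, card_c6960r1_17⟩
  refine List.forall_mem_cons.mpr ⟨?_, ?_⟩
  · exact ⟨17, 22, by decide +kernel, by decide, by decide +kernel, by decide +kernel, card_c7560e1_17⟩
  refine List.forall_mem_cons.mpr ⟨?_, ?_⟩
  · exact ⟨13, 14, by decide +kernel, by decide, by decide +kernel, by decide +kernel, card_c8085y1_13⟩
  refine List.forall_mem_cons.mpr ⟨?_, ?_⟩
  · exact ⟨7, 8, by decide +kernel, by decide, by decide +kernel, by decide +kernel, card_c8670u1_7⟩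
  refine List.forall_mem_cons.mpr ⟨?_, ?_⟩
  · exact ⟨11, 13, by decide +kernel, by decide, by decide +kernel, by decide +kernel, card_c8946p1_11⟩
  refine List.forall_mem_cons.mpr ⟨?_, ?_⟩
  · exact ⟨7, 7, by decide +kernel, by decide, by decide +kernel, by decide +kernel, card_c9090n1_7⟩
  refine List.forall_mem_cons.mpr ⟨?_, ?_⟩
  · exact ⟨11, 12, by decide +kernel, by decide, by decide +kernel, by decide +kernel, card_c9954j1_11⟩
  refine List.forall_mem_cons.mpr ⟨?_, ?_⟩
  · exact ⟨17, 13, by decide +kernel, by decide, by decide +kernel, by decide +kernel, card_c10080bo1_17⟩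
  refine List.forall_mem_cons.mpr ⟨?_, ?_⟩
  · exact ⟨11, 13, by decide +kernel, by decide, by decide +kernel, by decide +kernel, card_c10080ca1_11⟩
  refine List.forall_mem_cons.mpr ⟨?_, ?_⟩
  · exact ⟨17, 18, by decide +kernel, by decide, by decide +kernel, by decide +kernel, card_c10530r1_17⟩
  refine List.forall_mem_cons.mpr ⟨?_, ?_⟩
  · exact ⟨7, 9, by decide +kernel, by decide, by decide +kernel, by decide +kernel, card_c10890cc1_7⟩
  refine List.forall_mem_cons.mpr ⟨?_, ?_⟩
  · exact ⟨7, 7, by decide +kernel, by decide, by decide +kernel, by decide +kernel, card_c11280k1_7⟩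
  refine List.forall_mem_cons.mpr ⟨?_, ?_⟩
  · exact ⟨11, 11, by decide +kernel, by decide, by decide +kernel, by decide +kernel, card_c11340e1_11⟩
  refine List.forall_mem_cons.mpr ⟨?_, ?_⟩
  · exact ⟨13, 20, by decide +kernel, by decide, by decide +kernel, by decide +kernel, card_c11550cm1_13⟩
  refine List.forall_mem_cons.mpr ⟨?_, ?_⟩
  · exact ⟨13, 16, by decide +kernel, by decide, by decide +kernel, by decide +kernel, card_c11550cq1_13⟩
  refine List.forall_mem_cons.mpr ⟨?_, ?_⟩
  · exact ⟨11, 16, by decide +kernel, by decide, by decide +kernel, by decide +kernel, card_c11760bc1_11⟩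
  refine List.forall_mem_cons.mpr ⟨?_, ?_⟩
  · exact ⟨13, 15, by decide +kernel, by decide, by decide +kernel, by decide +kernel, card_c11970be1_13⟩
  refine List.forall_mem_cons.mpr ⟨?_, ?_⟩
  · exact ⟨7, 9, by decide +kernel, by decide, by decide +kernel, by decide +kernel, card_c12330w1_7⟩
  refine List.forall_mem_cons.mpr ⟨?_, ?_⟩
  · exact ⟨7, 9, by decide +kernel, by decide, by decide +kernel, by decide +kernel, card_c12360d1_7⟩
  refine List.forall_mem_cons.mpr ⟨?_, ?_⟩
  · exact ⟨7, 9, by decide +kernel, by decide, by decide +kernel, by decide +kernel, card_c12510n1_7⟩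
  refine List.forall_mem_cons.mpr ⟨?_, ?_⟩
  · exact ⟨7, 8, by decide +kernel, by decide, by decide +kernel, by decide +kernel, card_c12540k1_7⟩
  refine List.forall_mem_cons.mpr ⟨?_, ?_⟩
  · exact ⟨13, 10, by decide +kernel, by decide, by decide +kernel, by decide +kernel, card_c12705q1_13⟩
  refine List.forall_mem_cons.mpr ⟨?_, ?_⟩
  · exact ⟨11, 13, by decide +kernel, by decide, by decide +kernel, by decide +kernel, card_c12880g1_11⟩
  refine List.forall_mem_cons.mpr ⟨?_, ?_⟩
  · exact ⟨5, 3, by decide +kernel, by decide, by decide +kernel, by decide +kernel, card_c13104bu1_5⟩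
  refine List.forall_mem_cons.mpr ⟨?_, ?_⟩
  · exact ⟨13, 11, by decide +kernel, by decide, by decide +kernel, by decide +kernel, card_c13230bi1_13⟩
  refine List.forall_mem_cons.mpr ⟨?_, ?_⟩
  · exact ⟨13, 9, by decide +kernel, by decide, by decide +kernel, by decide +kernel, card_c13230bq1_13⟩
  refine List.forall_mem_cons.mpr ⟨?_, ?_⟩
  · exact ⟨11, 16, by decide +kernel, by decide, by decide +kernel, by decide +kernel, card_c13230cp1_11⟩
  refine List.forall_mem_cons.mpr ⟨?_, ?_⟩
  · exact ⟨11, 11, by decide +kernel, by decide, by decide +kernel, by decide +kernel, card_c13230dt1_11⟩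
  refine List.forall_mem_cons.mpr ⟨?_, ?_⟩
  · exact ⟨5, 8, by decide +kernel, by decide, by decide +kernel, by decide +kernel, card_c13662g1_5⟩
  refine List.forall_mem_cons.mpr ⟨?_, ?_⟩
  · exact ⟨7, 3, by decide +kernel, by decide, by decide +kernel, by decide +kernel, card_c14040b1_7⟩
  refine List.forall_mem_cons.mpr ⟨?_, ?_⟩
  · exact ⟨19, 13, by decide +kernel, by decide, by decide +kernel, by decide +kernel, card_c14130u1_19⟩
  refine List.forall_mem_cons.mpr ⟨?_, ?_⟩
  · exact ⟨19, 22, by decide +kernel, by decide, by decide +kernel, by decide +kernel, card_c14160e1_19⟩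
  refine List.forall_mem_cons.mpr ⟨?_, ?_⟩
  · exact ⟨3, 6, by decide +kernel, by decide, by decide +kernel, by decide +kernel, card_c14210d1_3⟩
  refine List.forall_mem_cons.mpr ⟨?_, ?_⟩
  · exact ⟨13, 16, by decide +kernel, by decide, by decide +kernel, by decide +kernel, card_c14490bs1_13⟩
  refine List.forall_mem_cons.mpr ⟨?_, ?_⟩
  · exact ⟨13, 16, by decide +kernel, by decide, by decide +kernel, by decide +kernel, card_c14490bv1_13⟩
  refine List.forall_mem_cons.mpr ⟨?_, ?_⟩
  · exact ⟨7, 4, by decide +kernel, by decide, by decide +kernel, by decide +kernel, card_c14520l1_7⟩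
  refine List.forall_mem_cons.mpr ⟨?_, ?_⟩
  · exact ⟨3, 6, by decide +kernel, by decide, by decide +kernel, by decide +kernel, card_c14560d1_3⟩
  refine List.forall_mem_cons.mpr ⟨?_, ?_⟩
  · exact ⟨7, 8, by decide +kernel, by decide, by decide +kernel, by decide +kernel, card_c15030p1_7⟩
  refine List.forall_mem_cons.mpr ⟨?_, ?_⟩
  · exact ⟨11, 11, by decide +kernel, by decide, by decide +kernel, by decide +kernel, card_c15190bi1_11⟩
  refine List.forall_mem_cons.mpr ⟨?_, ?_⟩
  · exact ⟨3, 7, by decide +kernel, by decide, by decide +kernel, by decide +kernel, card_c15190k1_3⟩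
  refine List.forall_mem_cons.mpr ⟨?_, ?_⟩
  · exact ⟨19, 22, by decide +kernel, by decide, by decide +kernel, by decide +kernel, card_c15210bi1_19⟩
  refine List.forall_mem_cons.mpr ⟨?_, ?_⟩
  · exact ⟨7, 9, by decide +kernel, by decide, by decide +kernel, by decide +kernel, card_c15390b1_7⟩
  refine List.forall_mem_cons.mpr ⟨?_, ?_⟩
  · exact ⟨7, 13, by decide +kernel, by decide, by decide +kernel, by decide +kernel, card_c15390r1_7⟩
  refine List.forall_mem_cons.mpr ⟨?_, ?_⟩
  · exact ⟨13, 14, by decide +kernel, by decide, by decide +kernel, by decide +kernel, card_c15390u1_13⟩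
  refine List.forall_mem_cons.mpr ⟨?_, ?_⟩
  · exact ⟨7, 7, by decide +kernel, by decide, by decide +kernel, by decide +kernel, card_c15390z1_7⟩
  refine List.forall_mem_cons.mpr ⟨?_, ?_⟩
  · exact ⟨11, 11, by decide +kernel, by decide, by decide +kernel, by decide +kernel, card_c15640h1_11⟩
  refine List.forall_mem_cons.mpr ⟨?_, ?_⟩
  · exact ⟨3, 4, by decide +kernel, by decide, by decide +kernel, by decide +kernel, card_c15730r1_3⟩
  refine List.forall_mem_cons.mpr ⟨?_, ?_⟩
  · exact ⟨7, 13, by decide +kernel, by decide, by decide +kernel, by decide +kernel, card_c15870y1_7⟩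
  refine List.forall_mem_cons.mpr ⟨?_, ?_⟩
  · exact ⟨7, 7, by decide +kernel, by decide, by decide +kernel, by decide +kernel, card_c15930l1_7⟩
  refine List.forall_mem_cons.mpr ⟨?_, ?_⟩
  · exact ⟨13, 9, by decide +kernel, by decide, by decide +kernel, by decide +kernel, card_c16065w1_13⟩
  refine List.forall_mem_cons.mpr ⟨?_, ?_⟩
  · exact ⟨13, 16, by decide +kernel, by decide, by decide +kernel, by decide +kernel, card_c16080i1_13⟩
  refine List.forall_mem_cons.mpr ⟨?_, ?_⟩
  · exact ⟨11, 11, by decide +kernel, by decide, by decide +kernel, by decide +kernel, card_c16110l1_11⟩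
  refine List.forall_mem_cons.mpr ⟨?_, ?_⟩
  · exact ⟨7, 13, by decide +kernel, by decide, by decide +kernel, by decide +kernel, card_c16320dd1_7⟩
  refine List.forall_mem_cons.mpr ⟨?_, ?_⟩
  · exact ⟨11, 16, by decide +kernel, by decide, by decide +kernel, by decide +kernel, card_c16560cf1_11⟩
  refine List.forall_mem_cons.mpr ⟨?_, ?_⟩
  · exact ⟨7, 3, by decide +kernel, by decide, by decide +kernel, by decide +kernel, card_c16680b1_7⟩
  refine List.forall_mem_cons.mpr ⟨?_, ?_⟩
  · exact ⟨7, 8, by decide +kernel, by decide, by decide +kernel, by decide +kernel, card_c16830cr1_7⟩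
  refine List.forall_mem_cons.mpr ⟨?_, ?_⟩
  · exact ⟨7, 8, by decide +kernel, by decide, by decide +kernel, by decide +kernel, card_c16830ct1_7⟩
  refine List.forall_mem_cons.mpr ⟨?_, ?_⟩
  · exact ⟨13, 14, by decide +kernel, by decide, by decide +kernel, by decide +kernel, card_c16905bb1_13⟩
  refine List.forall_mem_cons.mpr ⟨?_, ?_⟩
  · exact ⟨3, 7, by decide +kernel, by decide, by decide +kernel, by decide +kernel, card_c17360bo1_3⟩
  refine List.forall_mem_cons.mpr ⟨?_, ?_⟩
  · exact ⟨5, 8, by decide +kernel, by decide, by decide +kernel, by decide +kernel, card_c17388a1_5⟩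
  refine List.forall_mem_cons.mpr ⟨?_, ?_⟩
  · exact ⟨11, 18, by decide +kernel, by decide, by decide +kernel, by decide +kernel, card_c17520a1_11⟩
  refine List.forall_mem_cons.mpr ⟨?_, ?_⟩
  · exact ⟨23, 26, by decide +kernel, by decide, by decide +kernel, by decide +kernel, card_c17556e1_23⟩
  refine List.forall_mem_cons.mpr ⟨?_, ?_⟩
  · exact ⟨31, 31, by decide +kernel, by decide, by decide +kernel, by decide +kernel, card_c17745j1_31⟩
  refine List.forall_mem_cons.mpr ⟨?_, ?_⟩
  · exact ⟨7, 13, by decide +kernel, by decide, by decide +kernel, by decide +kernel, card_c17760b1_7⟩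
  refine List.forall_mem_cons.mpr ⟨?_, ?_⟩
  · exact ⟨7, 8, by decide +kernel, by decide, by decide +kernel, by decide +kernel, card_c17880o1_7⟩
  refine List.forall_mem_cons.mpr ⟨?_, ?_⟩
  · exact ⟨7, 3, by decide +kernel, by decide, by decide +kernel, by decide +kernel, card_c17940b1_7⟩
  refine List.forall_mem_cons.mpr ⟨?_, ?_⟩
  · exact ⟨29, 27, by decide +kernel, by decide, by decide +kernel, by decide +kernel, card_c17955m1_29⟩
  refine List.forall_mem_cons.mpr ⟨?_, ?_⟩
  · exact ⟨11, 8, by decide +kernel, by decide, by decide +kernel, by decide +kernel, card_c17955u1_11⟩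
  refine List.forall_mem_cons.mpr ⟨?_, ?_⟩
  · exact ⟨7, 8, by decide +kernel, by decide, by decide +kernel, by decide +kernel, card_c18360a1_7⟩
  refine List.forall_mem_cons.mpr ⟨?_, ?_⟩
  · exact ⟨3, 7, by decide +kernel, by decide, by decide +kernel, by decide +kernel, card_c18590d1_3⟩
  refine List.forall_mem_cons.mpr ⟨?_, ?_⟩
  · exact ⟨7, 9, by decide +kernel, by decide, by decide +kernel, by decide +kernel, card_c18590j1_7⟩
  refine List.forall_mem_cons.mpr ⟨?_, ?_⟩
  · exact ⟨7, 8, by decide +kernel, by decide, by decide +kernel, by decide +kernel, card_c18720bq1_7⟩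
  refine List.forall_mem_cons.mpr ⟨?_, ?_⟩
  · exact ⟨23, 22, by decide +kernel, by decide, by decide +kernel, by decide +kernel, card_c18774bd1_23⟩
  refine List.forall_mem_cons.mpr ⟨?_, ?_⟩
  · exact ⟨13, 9, by decide +kernel, by decide, by decide +kernel, by decide +kernel, card_c19170s1_13⟩
  refine List.forall_mem_cons.mpr ⟨?_, ?_⟩
  · exact ⟨13, 17, by decide +kernel, by decide, by decide +kernel, by decide +kernel, card_c19170u1_13⟩
  refine List.forall_mem_cons.mpr ⟨?_, ?_⟩
  · exact ⟨7, 9, by decide +kernel, by decide, by decide +kernel, by decide +kernel, card_c19665m1_7⟩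
  refine List.forall_mem_cons.mpr ⟨?_, ?_⟩
  · exact ⟨11, 11, by decide +kernel, by decide, by decide +kernel, by decide +kernel, card_c19890o1_11⟩
  intro r h
  simp at h

/-! ### §4. The five finite `Claim` conjuncts as kernel theorems, record by record -/

/-- **For every one of the 85 records: `Mult`, split type, `¬ Semistable`, (ram), `Irr` hold for the
record's curve IN THE KERNEL** (any instances; all three instance facts are themselves kernel
theorems). [cite: SilvermanAEC2009, VII.5 Prop. 5.1] [cite: Mazur1978, §6 Prop. 6.3 (1) (p. 153)] -/
theorem reduction_of_mem (r : Record) (hr : r ∈ records1 ++ records2)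
    [Fact r.p.Prime] [r.curve.IsElliptic] [r.curve.IsGloballyMinimal] :
    Mult r.curve r.p ∧ (r.split = true → r.curve.HasSplitMultiplicativeReductionAtPrime r.p) ∧
    (r.split = false → ¬ r.curve.HasSplitMultiplicativeReductionAtPrime r.p) ∧
    ¬ Semistable r.curve ∧ (r.ram ≠ [] → Ram r.curve r.p) ∧ Irr r.curve r.p := by
  haveI : NeZero r.p := ⟨(Fact.out : r.p.Prime).ne_zero⟩
  obtain ⟨⟨hpΔ, hpc4⟩, hsp, hnsp, ⟨b, -, hbprime, hbΔ, hbc4⟩, hram⟩ := reductionCert_all r hr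
  obtain ⟨ℓ, n, hℓprime, hℓp, hℓΔ, hnoroot, hcard⟩ := irrCert_all r hr
  have hlen : r.ainvs.length = 5 := (krausCriterion_all r hr).1
  rcases hA : r.ainvs with _ | ⟨a1, _ | ⟨a2, _ | ⟨a3, _ | ⟨a4, _ | ⟨a6, _ | ⟨x, t⟩⟩⟩⟩⟩⟩ <;>
    simp [hA] at hlen
  rw [hA] at hpΔ hpc4 hsp hnsp hbΔ hbc4 hram hℓΔ hcard
  set E₀ : WeierstrassCurve ℤ := ⟨a1, a2, a3, a4, a6⟩ with hE₀
  have hI : integralModelInt r.curve = E₀ := integralModelInt_curve r hA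
  have hΔ : E₀.Δ = discOf [a1, a2, a3, a4, a6] := intCurve_Δ a1 a2 a3 a4 a6
  have hc4 : E₀.c₄ = c4Of [a1, a2, a3, a4, a6] := intCurve_c₄ a1 a2 a3 a4 a6
  have hb2 := intCurve_b₂ a1 a2 a3 a4 a6
  have hb4 := intCurve_b₄ a1 a2 a3 a4 a6
  have hb6 := intCurve_b₆ a1 a2 a3 a4 a6
  have hpΔ' : (r.p : ℤ) ∣ E₀.Δ := by rw [hΔ]; exact hpΔ
  have hpc4' : ¬ (r.p : ℤ) ∣ E₀.c₄ := by rw [hc4]; exact hpc4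
  -- the node-tangent quadratic of `E₀` mod `p`, evaluated at `t : ℕ`, is the cast of the recheck's integer
  have hnode : ∀ t : ℕ,
      ((E₀.c₄ : ZMod r.p) * (t : ZMod r.p) ^ 2 + (E₀.a₁ * E₀.c₄ : ZMod r.p) * (t : ZMod r.p)
        - (54 * E₀.b₆ - 3 * E₀.b₂ * E₀.b₄ + E₀.a₂ * E₀.c₄ : ZMod r.p)) =
      ((c4Of [a1, a2, a3, a4, a6] * (t : ℤ) ^ 2 + [a1, a2, a3, a4, a6].getD 0 0 * c4Of [a1, a2, a3, a4, a6] * t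
        - (54 * (invariants [a1, a2, a3, a4, a6]).2.2.1
          - 3 * (invariants [a1, a2, a3, a4, a6]).1 * (invariants [a1, a2, a3, a4, a6]).2.1
          + [a1, a2, a3, a4, a6].getD 1 0 * c4Of [a1, a2, a3, a4, a6]) : ℤ) : ZMod r.p) := by
    intro t
    rw [hc4, hb2, hb4, hb6]
    simp only [hE₀, List.getD_cons_zero, List.getD_cons_succ]
    push_cast
    ring
  refine ⟨hasMultiplicativeReductionAtPrime_of_intModel hI r.p hpΔ' hpc4', ?_, ?_, ?_, ?_, ?_⟩
  · intro hs
    obtain ⟨t, -, ht⟩ := hsp hs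
    refine hasSplitMultiplicativeReductionAtPrime_of_intModel_of_root hI r.p hpΔ' hpc4' ⟨(t : ZMod r.p), ?_⟩
    rw [hnode, ZMod.intCast_zmod_eq_zero_iff_dvd]
    exact ht
  · intro hs
    refine not_hasSplitMultiplicativeReductionAtPrime_of_intModel_of_noroot hI r.p hpΔ' hpc4'
      (forall_zmod_of_forall_lt fun t ht ↦ ?_)
    rw [hnode, Ne, ZMod.intCast_zmod_eq_zero_iff_dvd]
    exact hnsp hs t ht
  · exact not_semistable_of_intModel hI b.1 (prime_of_isPrimeBelow504100 hbprime)
      (by rw [hΔ]; exact hbΔ) (by rw [hc4]; exact hbc4)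
  · intro hne
    obtain ⟨b', -, hprime', hne', hΔ', hc4', he, he', hpe⟩ := hram hne
    exact ram_of_intModel hI r.p b'.1 (prime_of_isPrimeBelow504100 hprime') hne'
      (by rw [hΔ]; exact hΔ') (by rw [hc4]; exact hc4') (e := b'.2.2) (by rw [hΔ]; exact he)
      (by rw [hΔ]; exact he') hpe
  · haveI : Fact ℓ.Prime := ⟨prime_of_isPrimeBelow504100 hℓprime⟩
    refine hasIrreducibleModPGaloisRep_of_intModel_of_noroot hI r.p ℓ hℓp (by rw [hΔ]; exact hℓΔ) hcard
      (forall_zmod_of_forall_lt fun t ht h0 ↦ hnoroot t ht ?_)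
    rw [← ZMod.intCast_zmod_eq_zero_iff_dvd]
    push_cast at h0 ⊢
    linear_combination h0

end Summit.BirchSwinnertonDyer.BirchSwinnertonDyer.Rank1Residual.X11RankOne
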